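import Literature.Geometry.Kaehler.DolbeaultSymbolCentre
import Literature.Geometry.Kaehler.TorusDolbeaultSymbol
import HarnessLib

/-!
# The `∂̄`-Laplacian transferred to the torus is a periodic elliptic operator (Warner 6.31, 6.35)

F. W. Warner, GTM 94 (1983), 6.31 ("there exists a periodic elliptic operator `L̃` which agrees
with `L` on `O₀`") and 6.35 (ellipticity of the Laplacian). For a compact Hermitian manifold and a
point `p` with cube data `(A, 𝒞)` (`TorusTransferOps`) we define the lattice operator of
`Δ_∂̄ = ∂̄∂̄* + ∂̄*∂̄` on `(k+1)`-forms transferred to the torus,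

  `torusLaplacian … = (∂̄̃ ∘ ∂̄*̃) + (∂̄*̃ ∘ ∂̄̃)`

(compositions and sum of the lattice operators of the transferred `∂̄`, `∂̄*` of
`ChartDolbeaultOps`, with the canonical fibre identifications `fibreIso`), compute its frozen
symbol — the scalar `-½ ‖ξ_k♯‖²_{g_p}` (`torusLaplacian_symbol`, from
`symbol_dolbeaultLaplacian_centre`) — and conclude that it is elliptic
(`torusLaplacian_isEllipticWith`).

## References

* F. W. Warner, GTM 94 (1983), 6.31, 6.35. [WarnerGTM94]
-/

noncomputable section

open scoped Manifold ContDiff Topology NNReal ENNReal RealInnerProductSpace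
open Bundle Set Function Module Metric Complex
open Literature.Analysis.FunctionSpaces Literature.NumberTheory.Transcendental

set_option maxSynthPendingDepth 2

namespace Literature.Geometry.Kaehler

/-! ### Canonical fibre identifications -/

section Fibre

variable (E : Type*) [NormedAddCommGroup E] [NormedSpace ℂ E] [FiniteDimensional ℂ E] (j : ℕ)

/-- The complex model covectors of degree `j` form a finite-dimensional complex space. [folklore] -/
instance finiteDimensional_complex_covectors : FiniteDimensional ℂ (E [⋀^Fin j]→L[ℝ] ℂ) :=
  haveI : FiniteDimensional ℝ (E [⋀^Fin j]→L[ℝ] ℂ) := ChartOp1.finiteDimensional_continuousAlternatingMap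
  Module.Finite.of_restrictScalars_finite ℝ ℂ (E [⋀^Fin j]→L[ℝ] ℂ)

/-- The dimension of the torus fibre in degree `j`. [folklore] -/
def fibreDim : ℕ := finrank ℂ (E [⋀^Fin j]→L[ℝ] ℂ)

/-- **The canonical fibre identification** of the complex model `j`-covectors with `ℂ^N`
(Warner 6.32: "`p`-forms become vector-valued functions … to `ℂᵐ`"). [cite: WarnerGTM94, 6.32] -/
def fibreIso : (E [⋀^Fin j]→L[ℝ] ℂ) ≃L[ℂ] EuclideanSpace ℂ (Fin (fibreDim E j)) :=
  ContinuousLinearEquiv.ofFinrankEq (by rw [fibreDim, finrank_euclideanSpace_fin])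

end Fibre

/-! ### The torus Laplacian in degree `k + 1` -/

section Laplacian

variable {E : Type*} [NormedAddCommGroup E] [NormedSpace ℂ E] [FiniteDimensional ℂ E]
  {n : ℕ} [Fact (finrank ℝ E = n)]
  {M : Type*} [TopologicalSpace M] [ChartedSpace E M] [IsManifold 𝓘(ℝ, E) ∞ M]
  [RiemannianBundle (fun x : M ↦ TangentSpace 𝓘(ℝ, E) x)]
  [IsContMDiffRiemannianBundle 𝓘(ℝ, E) ∞ E (fun x : M ↦ TangentSpace 𝓘(ℝ, E) x)]
  (o : (x : M) → Orientation ℝ (TangentSpace 𝓘(ℝ, E) x) (Fin n)) {k m m' : ℕ}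

omit [FiniteDimensional ℂ E] in
/-- The real dimension of the complex model space is even. [folklore] -/
theorem even_finrank_model (E : Type*) [NormedAddCommGroup E] [NormedSpace ℂ E] {n : ℕ} [Fact (finrank ℝ E = n)] :
    Even n := by
  have h : finrank ℝ E = n := Fact.out
  rw [← h, finrank_real_of_complex]
  exact even_two_mul _

/-- `∂̄` on `j`-forms transferred to the torus. [cite: WarnerGTM94, 6.31] -/
def torusDolbeaultBar (j : ℕ) {p : M} {A : E ≃L[ℝ] EuclideanSpace ℝ (Fin n)} (𝒞 : CubeCutoff p A) :
    Torus.FOp1 (Fin n) (EuclideanSpace ℂ (Fin (fibreDim E j))) (EuclideanSpace ℂ (Fin (fibreDim E (j + 1)))) :=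
  (dolbeaultBarOp E j).toFOp1 A (fibreIso E j) (fibreIso E (j + 1)) 𝒞
    (smoothOn_dolbeaultBarOp (isOpen_extChartAt_target p)) commI_dolbeaultBarOp.B commI_dolbeaultBarOp.C

/-- `∂̄*` on `(j+1)`-forms transferred to the torus. [cite: WarnerGTM94, 6.31] -/
def torusDolbeaultBarAdjoint (ho : IsSmoothForm (riemannianVolumeForm o)) {j mj : ℕ} (h : (j + 1) + mj = n)
    {p : M} {A : E ≃L[ℝ] EuclideanSpace ℝ (Fin n)} (𝒞 : CubeCutoff p A) :
    Torus.FOp1 (Fin n) (EuclideanSpace ℂ (Fin (fibreDim E (j + 1)))) (EuclideanSpace ℂ (Fin (fibreDim E j))) :=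
  (dolbeaultBarAdjointOp o h p).toFOp1 A (fibreIso E (j + 1)) (fibreIso E j) 𝒞
    (smoothOn_dolbeaultBarAdjointOp o ho h p) (commI_dolbeaultBarAdjointOp o h p).B (commI_dolbeaultBarAdjointOp o h p).C

/-- **The `∂̄`-Laplacian on `(k+1)`-forms transferred to the torus** (generic degree,
`(k+1) + (m+1) = n`): the lattice operator `∂̄̃ ∂̄*̃ + ∂̄*̃ ∂̄̃` (Warner 6.31's `L̃` for `Δ_∂̄`).
[cite: WarnerGTM94, 6.31] -/
def torusLaplacian (ho : IsSmoothForm (riemannianVolumeForm o)) (h₁ : (k + 1) + m = n) (h₃ : (k + 1 + 1) + m' = n)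
    {p : M} {A : E ≃L[ℝ] EuclideanSpace ℝ (Fin n)} (𝒞 : CubeCutoff p A) :
    Lattice.POp (Fin n) (EuclideanSpace ℂ (Fin (fibreDim E (k + 1)))) (EuclideanSpace ℂ (Fin (fibreDim E (k + 1)))) :=
  ((torusDolbeaultBar k 𝒞).toPOp1.comp (torusDolbeaultBarAdjoint o ho h₁ 𝒞).toPOp1).add
    ((torusDolbeaultBarAdjoint o ho h₃ 𝒞).toPOp1.comp (torusDolbeaultBar (k + 1) 𝒞).toPOp1)

/-- **The frozen symbol of the torus Laplacian is the scalar `-½ ‖ξ_k♯‖²_{g_p}`** (Hermitian metric).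
[cite: WarnerGTM94, 6.35] -/
theorem torusLaplacian_symbol (ho : IsSmoothForm (riemannianVolumeForm o))
    (hH : ∀ (x : M) (v w : TangentSpace 𝓘(ℝ, E) x), ⟪tangentJ E x v, tangentJ E x w⟫ = ⟪v, w⟫)
    (h₁ : (k + 1) + m = n) (h₃ : (k + 1 + 1) + m' = n) {p : M} {A : E ≃L[ℝ] EuclideanSpace ℝ (Fin n)}
    (𝒞 : CubeCutoff p A) (kv : Fin n → ℤ) (v : EuclideanSpace ℂ (Fin (fibreDim E (k + 1)))) :
    (torusLaplacian o ho h₁ h₃ 𝒞).symbol kv v =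
      -(((2⁻¹ * ‖(InnerProductSpace.toDual ℝ (TangentSpace 𝓘(ℝ, E) p)).symm (freqCovector A kv)‖ ^ 2 : ℝ) : ℂ) • v) := by
  have key := symbol_dolbeaultLaplacian_centre o p (even_finrank_model E) (hH p) (freqCovector A kv) h₁ h₃
    ((fibreIso E (k + 1)).symm v)
  rw [torusLaplacian, Lattice.POp.symbol_add, Lattice.POp1.symbol_comp, Lattice.POp1.symbol_comp,
    _root_.add_apply, ContinuousLinearMap.comp_apply, ContinuousLinearMap.comp_apply]
  simp only [torusDolbeaultBar, torusDolbeaultBarAdjoint, ChartOp1.symbol_toPOp1_toFOp1,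
    ContinuousLinearEquiv.symm_apply_apply]
  rw [← map_add, key, map_neg, map_smul, ContinuousLinearEquiv.apply_symm_apply]
  rfl

/-- **The torus Laplacian is elliptic** (Warner 6.35): its frozen symbol is bounded below by
`κ |k|²` with a positive `κ` depending only on the point and the cube map (not on the cut-off).
[cite: WarnerGTM94, 6.35] -/
theorem torusLaplacian_isEllipticWith (ho : IsSmoothForm (riemannianVolumeForm o))
    (hH : ∀ (x : M) (v w : TangentSpace 𝓘(ℝ, E) x), ⟪tangentJ E x v, tangentJ E x w⟫ = ⟪v, w⟫)
    (h₁ : (k + 1) + m = n) (h₃ : (k + 1 + 1) + m' = n) (p : M) (A : E ≃L[ℝ] EuclideanSpace ℝ (Fin n)) :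
    ∃ κ : ℝ, 0 < κ ∧ ∀ 𝒞 : CubeCutoff p A, (torusLaplacian o ho h₁ h₃ 𝒞).IsEllipticWith κ := by
  obtain ⟨C, hC, hge⟩ := norm_toDual_symm_freqCovector_ge (I := 𝓘(ℝ, E)) p A
  refine ⟨C / 2, by positivity, fun 𝒞 ↦ ?_⟩
  refine Lattice.POp.isEllipticWith_of_symbol_eq_neg_smul _
    (c := fun kv ↦ 2⁻¹ * ‖(InnerProductSpace.toDual ℝ (TangentSpace 𝓘(ℝ, E) p)).symm (freqCovector A kv)‖ ^ 2)
    (fun kv v ↦ torusLaplacian_symbol o ho hH h₁ h₃ 𝒞 kv v) (fun kv ↦ ?_) (fun kv ↦ by positivity)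
  have := hge kv
  linarith

/-- **The torus Laplacian in degree `0`** (`Δ_∂̄ = ∂̄*∂̄` on functions, `1 + m' = n`). [cite: WarnerGTM94, 6.31] -/
def torusLaplacianZero (ho : IsSmoothForm (riemannianVolumeForm o)) (h₃ : (0 + 1) + m' = n)
    {p : M} {A : E ≃L[ℝ] EuclideanSpace ℝ (Fin n)} (𝒞 : CubeCutoff p A) :
    Lattice.POp (Fin n) (EuclideanSpace ℂ (Fin (fibreDim E 0))) (EuclideanSpace ℂ (Fin (fibreDim E 0))) :=
  (torusDolbeaultBarAdjoint o ho h₃ 𝒞).toPOp1.comp (torusDolbeaultBar 0 𝒞).toPOp1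

/-- The frozen symbol of the degree-`0` torus Laplacian is the scalar `-½ ‖ξ_k♯‖²`. [cite: WarnerGTM94, 6.35] -/
theorem torusLaplacianZero_symbol (ho : IsSmoothForm (riemannianVolumeForm o))
    (hH : ∀ (x : M) (v w : TangentSpace 𝓘(ℝ, E) x), ⟪tangentJ E x v, tangentJ E x w⟫ = ⟪v, w⟫)
    (h₃ : (0 + 1) + m' = n) {p : M} {A : E ≃L[ℝ] EuclideanSpace ℝ (Fin n)}
    (𝒞 : CubeCutoff p A) (kv : Fin n → ℤ) (v : EuclideanSpace ℂ (Fin (fibreDim E 0))) :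
    (torusLaplacianZero o ho h₃ 𝒞).symbol kv v =
      -(((2⁻¹ * ‖(InnerProductSpace.toDual ℝ (TangentSpace 𝓘(ℝ, E) p)).symm (freqCovector A kv)‖ ^ 2 : ℝ) : ℂ) • v) := by
  have key := symbol_dolbeaultLaplacian_centre_zero o p (even_finrank_model E) (hH p) (freqCovector A kv) h₃
    ((fibreIso E 0).symm v)
  rw [torusLaplacianZero, Lattice.POp1.symbol_comp, ContinuousLinearMap.comp_apply]
  simp only [torusDolbeaultBar, torusDolbeaultBarAdjoint, ChartOp1.symbol_toPOp1_toFOp1,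
    ContinuousLinearEquiv.symm_apply_apply]
  rw [key, map_neg, map_smul, ContinuousLinearEquiv.apply_symm_apply]
  rfl

/-- The degree-`0` torus Laplacian is elliptic. [cite: WarnerGTM94, 6.35] -/
theorem torusLaplacianZero_isEllipticWith (ho : IsSmoothForm (riemannianVolumeForm o))
    (hH : ∀ (x : M) (v w : TangentSpace 𝓘(ℝ, E) x), ⟪tangentJ E x v, tangentJ E x w⟫ = ⟪v, w⟫)
    (h₃ : (0 + 1) + m' = n) (p : M) (A : E ≃L[ℝ] EuclideanSpace ℝ (Fin n)) :
    ∃ κ : ℝ, 0 < κ ∧ ∀ 𝒞 : CubeCutoff p A, (torusLaplacianZero o ho h₃ 𝒞).IsEllipticWith κ := by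
  obtain ⟨C, hC, hge⟩ := norm_toDual_symm_freqCovector_ge (I := 𝓘(ℝ, E)) p A
  refine ⟨C / 2, by positivity, fun 𝒞 ↦ ?_⟩
  refine Lattice.POp.isEllipticWith_of_symbol_eq_neg_smul _
    (c := fun kv ↦ 2⁻¹ * ‖(InnerProductSpace.toDual ℝ (TangentSpace 𝓘(ℝ, E) p)).symm (freqCovector A kv)‖ ^ 2)
    (fun kv v ↦ torusLaplacianZero_symbol o ho hH h₃ 𝒞 kv v) (fun kv ↦ ?_) (fun kv ↦ by positivity)
  have := hge kv
  linarith

/-- **The torus Laplacian in top degree** (`Δ_∂̄ = ∂̄∂̄*` on `n`-forms, `(k+1) + 0 = n`). [cite: WarnerGTM94, 6.31] -/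
def torusLaplacianTop (ho : IsSmoothForm (riemannianVolumeForm o)) (h₁ : (k + 1) + 0 = n)
    {p : M} {A : E ≃L[ℝ] EuclideanSpace ℝ (Fin n)} (𝒞 : CubeCutoff p A) :
    Lattice.POp (Fin n) (EuclideanSpace ℂ (Fin (fibreDim E (k + 1)))) (EuclideanSpace ℂ (Fin (fibreDim E (k + 1)))) :=
  (torusDolbeaultBar k 𝒞).toPOp1.comp (torusDolbeaultBarAdjoint o ho h₁ 𝒞).toPOp1

/-- The frozen symbol of the top-degree torus Laplacian is the scalar `-½ ‖ξ_k♯‖²`. [cite: WarnerGTM94, 6.35] -/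
theorem torusLaplacianTop_symbol (ho : IsSmoothForm (riemannianVolumeForm o))
    (hH : ∀ (x : M) (v w : TangentSpace 𝓘(ℝ, E) x), ⟪tangentJ E x v, tangentJ E x w⟫ = ⟪v, w⟫)
    (h₁ : (k + 1) + 0 = n) {p : M} {A : E ≃L[ℝ] EuclideanSpace ℝ (Fin n)}
    (𝒞 : CubeCutoff p A) (kv : Fin n → ℤ) (v : EuclideanSpace ℂ (Fin (fibreDim E (k + 1)))) :
    (torusLaplacianTop o ho h₁ 𝒞).symbol kv v =
      -(((2⁻¹ * ‖(InnerProductSpace.toDual ℝ (TangentSpace 𝓘(ℝ, E) p)).symm (freqCovector A kv)‖ ^ 2 : ℝ) : ℂ) • v) := by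
  have key := symbol_dolbeaultLaplacian_centre_top o p (even_finrank_model E) (hH p) (freqCovector A kv) h₁
    ((fibreIso E (k + 1)).symm v)
  rw [torusLaplacianTop, Lattice.POp1.symbol_comp, ContinuousLinearMap.comp_apply]
  simp only [torusDolbeaultBar, torusDolbeaultBarAdjoint, ChartOp1.symbol_toPOp1_toFOp1,
    ContinuousLinearEquiv.symm_apply_apply]
  rw [key, map_neg, map_smul, ContinuousLinearEquiv.apply_symm_apply]
  rfl

/-- The top-degree torus Laplacian is elliptic. [cite: WarnerGTM94, 6.35] -/
theorem torusLaplacianTop_isEllipticWith (ho : IsSmoothForm (riemannianVolumeForm o))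
    (hH : ∀ (x : M) (v w : TangentSpace 𝓘(ℝ, E) x), ⟪tangentJ E x v, tangentJ E x w⟫ = ⟪v, w⟫)
    (h₁ : (k + 1) + 0 = n) (p : M) (A : E ≃L[ℝ] EuclideanSpace ℝ (Fin n)) :
    ∃ κ : ℝ, 0 < κ ∧ ∀ 𝒞 : CubeCutoff p A, (torusLaplacianTop o ho h₁ 𝒞).IsEllipticWith κ := by
  obtain ⟨C, hC, hge⟩ := norm_toDual_symm_freqCovector_ge (I := 𝓘(ℝ, E)) p A
  refine ⟨C / 2, by positivity, fun 𝒞 ↦ ?_⟩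
  refine Lattice.POp.isEllipticWith_of_symbol_eq_neg_smul _
    (c := fun kv ↦ 2⁻¹ * ‖(InnerProductSpace.toDual ℝ (TangentSpace 𝓘(ℝ, E) p)).symm (freqCovector A kv)‖ ^ 2)
    (fun kv v ↦ torusLaplacianTop_symbol o ho hH h₁ 𝒞 kv v) (fun kv ↦ ?_) (fun kv ↦ by positivity)
  have := hge kv
  linarith

end Laplacian

end Literature.Geometry.Kaehler
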